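import Literature.Computability.AlgebraicComplexity.KoiranDivisionLemma
import Literature.Computability.AlgebraicComplexity.BurgisserThm41Proofs
import HarnessLib

/-!
# Bürgisser's Theorem 4.1(1): `τ(Per) = n^{O(1)} ⇒ τ(a(n)) = (log n)^{O(1)}` for `CH/poly`-definable integers — discharged

Sibling proof file of `TauConjectureProofs.lean` (D-0014) for the named fact
`Literature.Computability.AlgebraicComplexity.Burgisser2009_thm41_1` — Bürgisser, *On defining
integers in the counting hierarchy and proving lower bounds in algebraic complexity*, ECCC
TR06-113 (2006) = Comput. Complexity 18 (2009), **Thm. 4.1(1)**: if `τ(Per_n)` is polynomially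
bounded then every sequence of integers `(a(n))` definable in `CH/poly` has
`τ(a(n)) = (log n)^{O(1)}`. The printed proof (p. 14) is an assembly of five results, all of which
are now theorems of the tree:

1. Lemma 2.12 (`τ(Per) = n^{O(1)} ⇒ PP ⊆ P/poly`): `PP_subset_PPoly_of_isPBounded_perPoly_holds`
   (`SharpPBitsPPoly.lean`);
2. Lemma 2.5(2) (`PP ⊆ P/poly ⇒ CH ⊆ P/poly`): `CH_subset_PPoly_of_PP_subset_PPoly_holds`, together
   with `CH/poly ⊆ (P/poly)/poly = P/poly` (`polyAdvice_subset_PPoly`);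
3. Thm. 2.11 as applied (the Koiran step): `Burgisser2009_thm41_koiranStep_holds` (`KoiranCriterion.lean`);
4. Thm. 2.10: `Burgisser2009_thm210_holds` (`BurgisserThm210Proofs.lean`) — steps 3–4 enter through
   the `P/poly` form of the core bound, `thm41_2_signPart_PPoly` (`BurgisserThm41Proofs.lean`);
5. Koiran's Lemma 4.4 (Koiran 2004), `τ(a) ≤ (2e + 3) τ(2^e a)`:
   `constantFreeComplexity_C_le_of_two_pow_mul` (`KoiranDivisionLemma.lean`, with the immaterial
   constant `4e + 5`).

Contents (theorems only): `tauInt_eq_constantFreeComplexity_C` (`τ` of an integer is `τ` of the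
constant of `MvPolynomial (Fin 1) ℤ`), `constantFreeComplexity_C_le_natAbs_succ`
(`τ(a) ≤ τ(|a|) + 1`), `sum_ite_testBit_C_two_pow` (reading an integer off its bits),
`Burgisser2009_thm41_1_of_lemma212` (Thm. 4.1(1) from Lemma 2.12), `Burgisser2009_thm41_1_of_valiant`
(from Valiant's `#P`-hardness of the `0/1` permanent), and the DISCHARGE
**`Burgisser2009_thm41_1_holds`**.

Proof of Thm. 4.1(1) as assembled here (p. 14 of the source, with two harmless deviations): the
bit language `Bit(|a|)` of Def. 3.1 is in `CH/poly ⊆ P/poly`; re-encoded by the `FP` map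
`⟨⟨n, k⟩, ⟨j, b⟩⟩ ↦ ⟨n, ⟨j, b⟩⟩` (`preimage_mem_PPoly`) it is a `P/poly`-decidable bit array
`b(n, k, j) = bit_j |a(n)|` constant in the dummy index `k ≤ q(n) := 0`, so the Koiran step and
Thm. 2.10 give `τ(2^{e(n)} |a(n)|) ≤ (log₂ n + 2)^{c}` with `e(n) = s(r(n))` polylogarithmic
(`A_n(2^{2^0}, …, 2^{2^{ℓ-1}}) = |a(n)|`); Koiran's Lemma 4.4 removes the power of two,
`τ(|a(n)|) ≤ (4 e(n) + 5)(log₂ n + 2)^{c}`, and `τ(a(n)) ≤ τ(|a(n)|) + 1`. Deviations from the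
printed text: the source treats `a(n)` as nonnegative ("let `a(n) = ∑ a(n,j) 2^j` be the binary
representation") — we run the argument for `|a(n)|`, whose bits ARE the language `Bit(|a|)` of
Def. 3.1, and negate at the end (the sign language is not needed); and the printed constant of
Lemma 4.4 is `2e + 3` (one shared table of powers of two) where the tree proves `4e + 5`.

## References

* P. Bürgisser, *On defining integers in the counting hierarchy and proving lower bounds in
  algebraic complexity*, ECCC TR06-113 (2006), Lemma 2.5, Thm. 2.10, Thm. 2.11, Lemma 2.12,
  Def. 3.1, Thm. 4.1(1) and its proof, p. 14 (read on the page); journal version *On defining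
  integers and proving arithmetic circuit lower bounds*, Comput. Complexity 18 (2009) 81–103.
* P. Koiran, *Valiant's model and the cost of computing integers*, Comput. Complexity 13 (2004)
  131–146, Lemma 4.4 (as quoted by Bürgisser, loc. cit., p. 14: `τ(a(n)) ≤ (2e(n)+3) τ(2^{e(n)} a(n))`),
  Thm. 6.1.
* L. G. Valiant, *The complexity of computing the permanent*, TCS 8 (1979) 189–201, Thm. 1.
-/

noncomputable section

open MvPolynomial

namespace Literature.Computability.AlgebraicComplexity

section Assembly

open Computability Literature.Computability.Complexity Brick

/-- `τ` of an integer is `τ` of the corresponding constant of `MvPolynomial (Fin 1) ℤ`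
(`tauInt a = tauPoly (C a)`, through `uniqueAlgEquiv`). [cite: Burgisser2006, Def. 2.6] -/
theorem tauInt_eq_constantFreeComplexity_C (a : ℤ) :
    tauInt a = constantFreeComplexity (C a : MvPolynomial (Fin 1) ℤ) := by
  rw [tauInt, tauPoly_def, MvPolynomial.uniqueAlgEquiv_symm_apply, Polynomial.eval₂_C]

/-- `τ(a) ≤ τ(|a|) + 1` (negate if `a < 0`). [folklore] -/
theorem constantFreeComplexity_C_le_natAbs_succ {ι : Type*} (a : ℤ) :
    constantFreeComplexity (C a : MvPolynomial ι ℤ) ≤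
      constantFreeComplexity (C (a.natAbs : ℤ) : MvPolynomial ι ℤ) + 1 := by
  rcases le_or_gt 0 a with ha | ha
  · rw [Int.natAbs_of_nonneg ha]; exact Nat.le_succ _
  · have : (C a : MvPolynomial ι ℤ) = -C (a.natAbs : ℤ) := by
      rw [← map_neg, Int.ofNat_natAbs_of_nonpos ha.le, neg_neg]
    rw [this]
    exact constantFreeComplexity_neg_le _

/-- The bit polynomial of a natural number `m < 2^{N+1}`, read off in `MvPolynomial (Fin 1) ℤ`:
`∑_{j ≤ N} [bit_j m] 2^j = m` (the identity `A_n(2^{2^0}, …, 2^{2^{ℓ-1}}) = a(n)` of p. 14 after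
the specialisation `aeval_twoBlockPoly_powers`). [cite: Burgisser2006, proof of Thm. 4.1(1)] -/
theorem sum_ite_testBit_C_two_pow {m N : ℕ} (h : m < 2 ^ (N + 1)) :
    (∑ j ∈ Finset.range (N + 1),
        if m.testBit j then (C (2 : ℤ) : MvPolynomial (Fin 1) ℤ) ^ j else 0) = C (m : ℤ) := by
  rw [map_ofNat C 2, sum_ite_testBit_two_pow h, ← map_natCast C]

/-- **Bürgisser's Theorem 4.1(1) from Lemma 2.12** (ECCC TR06-113, Thm. 4.1(1), proof p. 14):
if `τ(Per_n) = n^{O(1)}` implies `PP ⊆ P/poly` (Lemma 2.12, the named fact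
`PP_subset_PPoly_of_isPBounded_perPoly`), then `τ(Per_n) = n^{O(1)}` implies
`τ(a(n)) = (log n)^{O(1)}` for every integer sequence `(a(n))` definable in `CH/poly`. Lemma 2.5(2),
Thm. 2.10, the Koiran step (Thm. 2.11 as applied) and Koiran's Lemma 4.4 are theorems of the
tree. [cite: Burgisser2006, Thm. 4.1(1)] -/
theorem Burgisser2009_thm41_1_of_lemma212 (h212 : PP_subset_PPoly_of_isPBounded_perPoly) :
    Burgisser2009_thm41_1 := by
  intro hτ a ha
  obtain ⟨⟨c, hc⟩, -, ⟨B, hB, hB'⟩⟩ := ha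
  -- Lemma 2.12 and Lemma 2.5(2): `CH ⊆ P/poly`, hence `CH/poly ⊆ P/poly`
  have hCHP : CH ⊆ PPoly := CH_subset_PPoly_of_PP_subset_PPoly_holds (h212 hτ)
  have hBP : B ∈ PPoly := polyAdvice_subset_PPoly hCHP hB
  -- the bit language of `|a|` in the query format `⟨⟨n, k⟩, ⟨j, b⟩⟩` of Def. 3.1 (dummy `k`)
  have hg : fanoutFn (fstF ∘ fstF) sndF ∈ FP :=
    fanoutFn_mem_FP (comp_mem_FP fstF_mem_FP fstF_mem_FP) sndF_mem_FP
  have hL : fanoutFn (fstF ∘ fstF) sndF ⁻¹' B ∈ PPoly := preimage_mem_PPoly hBP hg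
  have hagree : ∀ n k j, k ≤ (fun _ : ℕ => 0) n →
      (encBitQuery n k j true ∈ fanoutFn (fstF ∘ fstF) sndF ⁻¹' B ↔
        (fun n (_ : ℕ) j => (a n).natAbs.testBit j) n k j = true) := by
    intro n k j _
    simp only [Set.mem_preimage, fanoutFn_apply, Function.comp_apply, encBitQuery, encIdx,
      fstF_boolPair, sndF_boolPair]
    exact hB' n j true
  -- the bit bound `p(n) = n^c + n ≥ n`, the dummy bound `q = 0`
  have hp : IsPBounded (fun n => n ^ c + n) :=
    IsPBounded.add_holds (IsPBounded.pow_holds IsPBounded.id c) IsPBounded.id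
  have hpn : ∀ n, n ≤ n ^ c + n := fun n => Nat.le_add_left _ _
  have hq : IsPBounded (fun _ : ℕ => 0) := IsPBounded.const 0
  -- Thm. 2.11 (Koiran step) and Thm. 2.10
  obtain ⟨s, hs, c₁, hc₁⟩ := thm41_2_signPart_PPoly hτ Burgisser2009_thm210_holds
    Burgisser2009_thm41_koiranStep_holds hp hq hpn (fun n _ j => (a n).natAbs.testBit j) hL hagree
  -- the bound for `n ≥ 2`
  have key : ∀ n, 2 ≤ n → tauInt (a n) ≤
      (4 * s (Nat.pair (bitLen (n ^ c + n)) (bitLen 0)) + 5) * (Nat.log 2 n + 2) ^ c₁ + 1 := by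
    intro n hn
    have hbits : (a n).natAbs < 2 ^ (n ^ c + n + 1) := by
      have h1 : |a n| ≤ 2 ^ (n ^ c) := hc n hn
      have h2 : ((a n).natAbs : ℤ) ≤ 2 ^ (n ^ c) := by rwa [Int.natCast_natAbs]
      have h3 : (a n).natAbs ≤ 2 ^ (n ^ c) := by exact_mod_cast h2
      exact lt_of_le_of_lt h3 (Nat.pow_lt_pow_right (by norm_num) (by omega))
    -- `τ(2^{s(r n)} |a n|) ≤ (log₂ n + 2)^{c₁}`
    have hsc := hc₁ n
    rw [Finset.sum_range_one, pow_zero, mul_one, sum_ite_testBit_C_two_pow hbits, ← C_mul] at hsc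
    -- Koiran's Lemma 4.4 and the sign
    rw [tauInt_eq_constantFreeComplexity_C]
    calc constantFreeComplexity (C (a n) : MvPolynomial (Fin 1) ℤ)
        ≤ constantFreeComplexity (C ((a n).natAbs : ℤ) : MvPolynomial (Fin 1) ℤ) + 1 :=
          constantFreeComplexity_C_le_natAbs_succ _
      _ ≤ (4 * s (Nat.pair (bitLen (n ^ c + n)) (bitLen 0)) + 5) *
            constantFreeComplexity (C ((2 : ℤ) ^ s (Nat.pair (bitLen (n ^ c + n)) (bitLen 0)) *
              ((a n).natAbs : ℤ)) : MvPolynomial (Fin 1) ℤ) + 1 :=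
          Nat.add_le_add_right (constantFreeComplexity_C_le_of_two_pow_mul _ _) 1
      _ ≤ (4 * s (Nat.pair (bitLen (n ^ c + n)) (bitLen 0)) + 5) * (Nat.log 2 n + 2) ^ c₁ + 1 := by
          gcongr
  -- the right-hand side is polylog
  have hr : ∃ c' : ℕ, ∀ n, Nat.pair (bitLen (n ^ c + n)) (bitLen ((fun _ : ℕ => 0) n)) ≤
      (Nat.log 2 n + 2) ^ c' := polylog_pair_bitLen hp hq
  obtain ⟨c₂, hc₂⟩ : ∃ c₂ : ℕ, ∀ n,
      (4 * s (Nat.pair (bitLen (n ^ c + n)) (bitLen 0)) + 5) * (Nat.log 2 n + 2) ^ c₁ + 1 ≤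
        (Nat.log 2 n + 2) ^ c₂ :=
    polylog_add (polylog_mul (polylog_add (polylog_mul (polylog_const 4) (polylog_comp hs hr))
      (polylog_const 5)) ⟨c₁, fun _ => le_rfl⟩) (polylog_const 1)
  exact polylog_of_two_le fun n hn => (key n hn).trans (hc₂ n)

/-- **Bürgisser's Theorem 4.1(1) from Valiant's theorem alone**: with Lemma 2.12 derived from the
`#P`-hardness of the `0/1` permanent (`PP_subset_PPoly_of_isPBounded_perPoly_of_valiant`,
`PermanentBitsPPoly.lean`), Thm. 4.1(1) rests on the single classical named fact
`Valiant1979_per01Plain_isSharpPHardFun` (Valiant 1979, Thm. 1). [cite: Burgisser2006, Thm. 4.1(1)] -/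
theorem Burgisser2009_thm41_1_of_valiant (hV : Valiant1979_per01Plain_isSharpPHardFun) :
    Burgisser2009_thm41_1 :=
  Burgisser2009_thm41_1_of_lemma212 (PP_subset_PPoly_of_isPBounded_perPoly_of_valiant hV)

/-! ### The discharge -/

/-- **Bürgisser's Theorem 4.1(1) — discharged** (ECCC TR06-113, Thm. 4.1(1) = Comput. Complexity
18 (2009), Thm. 4.1(1) = STACS 2007, Thm. 16(1)): if `τ(Per_n) = n^{O(1)}` then every sequence of
integers `(a(n))` definable in `CH/poly` has `τ(a(n)) = (log n)^{O(1)}`. All five steps of the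
printed proof are theorems of the tree: Lemma 2.12 (`PP_subset_PPoly_of_isPBounded_perPoly_holds`,
`SharpPBitsPPoly.lean`), Lemma 2.5(2) (`CH_subset_PPoly_of_PP_subset_PPoly_holds`), Thm. 2.10
(`Burgisser2009_thm210_holds`), the application of Thm. 2.11 (`Burgisser2009_thm41_koiranStep_holds`)
and Koiran's Lemma 4.4 (`constantFreeComplexity_C_le_of_two_pow_mul`). [cite: Burgisser2006, Thm. 4.1(1)] -/
theorem Burgisser2009_thm41_1_holds : Burgisser2009_thm41_1 :=
  Burgisser2009_thm41_1_of_lemma212 PP_subset_PPoly_of_isPBounded_perPoly_holds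

/-- Thm. 4.1(1), unfolded: under `τ(Per_n) = n^{O(1)}`, a `CH/poly`-definable integer sequence has
`τ(a(n)) ≤ (log₂ n + 2)^c` for some `c` and all `n`. [cite: Burgisser2006, Thm. 4.1(1)] -/
theorem tauInt_le_polylog_of_isCHPolyDefinable₁
    (hτ : IsPBounded fun n => constantFreeComplexity (perPoly (Fin n) ℤ)) {a : ℕ → ℤ}
    (ha : IsCHPolyDefinable₁ a) : ∃ c : ℕ, ∀ n, tauInt (a n) ≤ (Nat.log 2 n + 2) ^ c :=
  Burgisser2009_thm41_1_holds hτ a ha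

/-- In particular (Bürgisser, ECCC TR06-113, proof of Thm. 1.1(1), p. 15, with Cor. 3.8 replaced by
its `CH/poly` hypothesis form): under `τ(Per_n) = n^{O(1)}`, a `CH`-definable integer sequence —
e.g. `(n!)` once Cor. 3.8 is available — is easy to compute, by `CH ⊆ CH/poly`. [cite: Burgisser2006, Thm. 4.1(1)] -/
theorem tauInt_le_polylog_of_isCHDefinable₁
    (hτ : IsPBounded fun n => constantFreeComplexity (perPoly (Fin n) ℤ)) {a : ℕ → ℤ}
    (ha : IsCHDefinable₁ a) : ∃ c : ℕ, ∀ n, tauInt (a n) ≤ (Nat.log 2 n + 2) ^ c :=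
  Burgisser2009_thm41_1_holds hτ a ha.isCHPolyDefinable₁

end Assembly

end Literature.Computability.AlgebraicComplexity
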